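import Summits.Ventures.LatticeQCDFlow.Exactness.Phi4LocalMetropolisExact
import Summits.Ventures.LatticeQCDFlow.Exactness.FreeFieldOverrelaxationExact
import HarnessLib

/-!
# Sweeps of exact single-site updates are exact: the engine's sequential Metropolis, heat-bath and over-relaxation sweeps on `ℝ^Λ`

HONEST FRAMING: exact (Metropolis-corrected) sampling algorithms for lattice gauge theory;
figures of merit are autocorrelation/cost numbers at stated couplings and volumes; no
continuum-physics claim.  (SCALAR calibration rung S0-A: not a gauge result.)

Venture `LatticeQCDFlow` (cell pub-lqcd), topic `Exactness`; FANOUT row 2 (`s0-phi4`).  NEW WORK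
of the cell (an induction over the visiting list); nothing is cited as a fact.  The finite-space
statement "a sequential scan of π-invariant kernels is π-invariant" is `Exactness/SequentialScanAdjoint.lean`
(row 9); this file is its counterpart for the concrete operators on `Fin (n+1) → ℝ` of
`Exactness/Phi4LocalMetropolisExact.lean` (interacting φ⁴, Metropolis),
`Exactness/FreeFieldHeatBathExact.lean` and `Exactness/FreeFieldOverrelaxationExact.lean` (free
field, heat bath / Adler), which were stated one site at a time or for the RANDOM scan.  The
engine's local sweeps visit the sites in a fixed ORDER; that case is closed here.

## What is proved

* `sweepOp M l f` — the operator of the sweep along the site list `l` (`M x` applied in turn;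
  `sweepOp_cons`).
* **`sweep_exact`** — if every `M x` (i) fixes `∫ (M_x f) W = ∫ f W` for all bounded measurable
  `f`, (ii) maps measurable to measurable and (iii) keeps the bound `|M_x f| ≤ B`, then every sweep
  (any order, any repetitions) has all three properties — in particular `∫ (Sweep f) W = ∫ f W`.
* Instances: **`metropolis_sweep_exact`** / `metropolis_sweep_exact_phi4` — the sequential
  random-walk Metropolis sweep of INTERACTING lattice φ⁴ (every `λ > 0`, every real `J`, every even
  proposal density, every visiting list) leaves `e^{−S}dφ/Z` invariant: `⟨Sweep f⟩ = ⟨f⟩` for all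
  bounded measurable `f`; **`heatBath_sweep_exact`** — the ordered heat-bath sweep of the free field
  (the Gauss–Seidel-with-noise iteration of `Scoring/HeatBathGaussSeidel.lean`) is exact;
  **`overrelaxation_sweep_exact`** — so is Adler's ordered over-relaxed sweep for every
  `ω ∈ (0, 2)` (SOR with noise); `heatBath_fullSweep_exact_shift` — the engine instance: the
  lexicographic sweep `List.finRange (n+1)` of heat baths on `J = −Δ_lat + m²`, `m² > 0`.

With these, every sampler of the S0-A calibration that touches one site at a time is typed as
EXACT on `ℝ^Λ` for the action it actually samples (Metropolis: φ⁴ at any `λ > 0`; heat bath /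
over-relaxation: the free field), in the integrated form `∫ (K f) e^{−S} = ∫ f e^{−S}` over all
bounded measurable observables — which characterises invariance of the finite measure
`e^{−S}dφ`.  NOT CLAIMED: irreducibility / convergence to equilibrium, spectral gaps of the
ordered sweeps.
-/

namespace Summit.Ventures.LatticeQCDFlow.Exactness

open Real MeasureTheory Finset Filter
open Summit.Ventures.LatticeQCDFlow.Scoring

variable {n : ℕ}

/-- The operator of a SWEEP: apply the single-site operators `M x` along the list of sites `l`
(as operators on observables, `(M_{x₁} ∘ M_{x₂} ∘ ⋯)(f)`; on measures this is the sweep visiting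
the sites of `l` in order). -/
def sweepOp (M : Fin (n + 1) → ((Fin (n + 1) → ℝ) → ℝ) → ((Fin (n + 1) → ℝ) → ℝ))
    (l : List (Fin (n + 1))) (f : (Fin (n + 1) → ℝ) → ℝ) : (Fin (n + 1) → ℝ) → ℝ :=
  l.foldr (fun x g => M x g) f

/-- Unfolding a sweep one site at a time. -/
theorem sweepOp_cons (M : Fin (n + 1) → ((Fin (n + 1) → ℝ) → ℝ) → ((Fin (n + 1) → ℝ) → ℝ))
    (x : Fin (n + 1)) (l : List (Fin (n + 1))) (f : (Fin (n + 1) → ℝ) → ℝ) :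
    sweepOp M (x :: l) f = M x (sweepOp M l f) := rfl

/-- **A sweep of exact, measurability- and bound-preserving single-site updates is exact.**
If every `M x` fixes the weighted integral of every bounded measurable observable and maps bounded
measurable observables to bounded measurable ones (same bound), then so does every sweep, in any
order, with any repetitions. -/
theorem sweep_exact {W : (Fin (n + 1) → ℝ) → ℝ}
    {M : Fin (n + 1) → ((Fin (n + 1) → ℝ) → ℝ) → ((Fin (n + 1) → ℝ) → ℝ)}
    (hex : ∀ (x : Fin (n + 1)) (f : (Fin (n + 1) → ℝ) → ℝ) (B : ℝ), Measurable f →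
      (∀ φ, |f φ| ≤ B) → ∫ φ, M x f φ * W φ = ∫ φ, f φ * W φ)
    (hmeas : ∀ (x : Fin (n + 1)) (f : (Fin (n + 1) → ℝ) → ℝ), Measurable f → Measurable (M x f))
    (hbdd : ∀ (x : Fin (n + 1)) (f : (Fin (n + 1) → ℝ) → ℝ) (B : ℝ), (∀ φ, |f φ| ≤ B) →
      ∀ φ, |M x f φ| ≤ B)
    (l : List (Fin (n + 1))) {f : (Fin (n + 1) → ℝ) → ℝ} (hfm : Measurable f) {B : ℝ}
    (hfb : ∀ φ, |f φ| ≤ B) :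
    (∫ φ, sweepOp M l f φ * W φ = ∫ φ, f φ * W φ) ∧ Measurable (sweepOp M l f)
      ∧ ∀ φ, |sweepOp M l f φ| ≤ B := by
  induction l with
  | nil => exact ⟨rfl, hfm, hfb⟩
  | cons x l ih =>
      obtain ⟨h1, h2, h3⟩ := ih
      refine ⟨?_, hmeas x _ h2, hbdd x _ B h3⟩
      rw [sweepOp_cons, hex x _ B h2 h3, h1]

/-! ## The engine's sweeps -/

/-- **The sequential Metropolis sweep of lattice φ⁴ is exact** (coercive action — every `λ > 0`
by `latticePhi4Action_coercive` — even proposal density, any visiting order `l`, any number of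
hits per site): `∫ (Sweep f) e^{−S} dφ = ∫ f e^{−S} dφ` for every bounded measurable `f`. -/
theorem metropolis_sweep_exact {J : Fin (n + 1) → Fin (n + 1) → ℝ} {lam ε K : ℝ} (hε : 0 < ε)
    (hS : ∀ φ : Fin (n + 1) → ℝ, ε * ∑ w, φ w ^ 2 - K ≤ latticePhi4Action J lam φ)
    {ρ : ℝ → ℝ} (hρ0 : ∀ u, 0 ≤ ρ u) (hρm : Measurable ρ) (hρi : Integrable ρ)
    (hρ1 : ∫ u, ρ u = 1) (hρs : ∀ u, ρ (-u) = ρ u) (l : List (Fin (n + 1)))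
    {f : (Fin (n + 1) → ℝ) → ℝ} (hfm : Measurable f) {B : ℝ} (hfb : ∀ φ, |f φ| ≤ B) :
    ∫ φ, sweepOp (metroSite J lam ρ) l f φ * gibbsWeight J lam φ
      = ∫ φ, f φ * gibbsWeight J lam φ :=
  (sweep_exact (W := gibbsWeight J lam) (M := metroSite J lam ρ)
    (fun x _ _ hg hb => metropolis_site_exact hε hS x hρ0 hρm hρi hρ1 hρs hg hb)
    (fun x _ hg => (measurable_metroSite J lam hρm x hg).measurable)
    (fun x _ _ hb => abs_metroSite_le J lam hρ0 hρi hρ1 x hb) l hfm hfb).1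

/-- **Normalised, for `λ > 0`**: `⟨Sweep f⟩ = ⟨f⟩` for the sequential Metropolis sweep of φ⁴,
every real coupling matrix `J`. -/
theorem metropolis_sweep_exact_phi4 {lam : ℝ} (hlam : 0 < lam) (J : Fin (n + 1) → Fin (n + 1) → ℝ)
    {ρ : ℝ → ℝ} (hρ0 : ∀ u, 0 ≤ ρ u) (hρm : Measurable ρ) (hρi : Integrable ρ)
    (hρ1 : ∫ u, ρ u = 1) (hρs : ∀ u, ρ (-u) = ρ u) (l : List (Fin (n + 1)))
    {f : (Fin (n + 1) → ℝ) → ℝ} (hfm : Measurable f) {B : ℝ} (hfb : ∀ φ, |f φ| ≤ B) :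
    gibbsExpect J lam (sweepOp (metroSite J lam ρ) l f) = gibbsExpect J lam f := by
  unfold gibbsExpect
  rw [metropolis_sweep_exact one_pos (latticePhi4Action_coercive hlam J) hρ0 hρm hρi hρ1 hρs l
    hfm hfb]

/-- **The ORDERED heat-bath sweep of the free field is exact** (coercive `S = ΣφJφ`, all
`J_{xx} > 0`; any visiting order): the Gauss–Seidel-with-noise sweep of
`Scoring/HeatBathGaussSeidel.lean` leaves `e^{−S}dφ/Z` invariant. -/
theorem heatBath_sweep_exact {J : Fin (n + 1) → Fin (n + 1) → ℝ} {ε K : ℝ} (hε : 0 < ε)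
    (hS : ∀ φ : Fin (n + 1) → ℝ, ε * ∑ w, φ w ^ 2 - K ≤ latticePhi4Action J 0 φ)
    (hJ : ∀ x, 0 < J x x) (l : List (Fin (n + 1))) {f : (Fin (n + 1) → ℝ) → ℝ}
    (hfm : Measurable f) {B : ℝ} (hfb : ∀ φ, |f φ| ≤ B) :
    ∫ φ, sweepOp (siteUpdate J 1) l f φ * gibbsWeight J 0 φ = ∫ φ, f φ * gibbsWeight J 0 φ :=
  (sweep_exact (W := gibbsWeight J 0) (M := siteUpdate J 1)
    (fun x _ _ hg hb => heatBath_site_exact hε hS x (hJ x) hg hb)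
    (fun x _ hg => (measurable_siteUpdate J x (hJ x) hg).measurable)
    (fun x _ _ hb => abs_siteUpdate_le J x hb) l hfm hfb).1

/-- **The ordered over-relaxed sweep (`0 < ω < 2`) of the free field is exact** — Adler's
algorithm as run: SOR-with-noise, any visiting order. -/
theorem overrelaxation_sweep_exact {J : Fin (n + 1) → Fin (n + 1) → ℝ} {ε K : ℝ} (hε : 0 < ε)
    (hS : ∀ φ : Fin (n + 1) → ℝ, ε * ∑ w, φ w ^ 2 - K ≤ latticePhi4Action J 0 φ)
    (hJ : ∀ x, 0 < J x x) {ω : ℝ} (hω0 : 0 < ω) (hω2 : ω < 2) (l : List (Fin (n + 1)))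
    {f : (Fin (n + 1) → ℝ) → ℝ} (hfm : Measurable f) {B : ℝ} (hfb : ∀ φ, |f φ| ≤ B) :
    ∫ φ, sweepOp (siteUpdate J ω) l f φ * gibbsWeight J 0 φ = ∫ φ, f φ * gibbsWeight J 0 φ :=
  (sweep_exact (W := gibbsWeight J 0) (M := siteUpdate J ω)
    (fun x _ _ hg hb => overrelaxation_site_exact hε hS x (hJ x) hω0 hω2 hg hb)
    (fun x _ hg => (measurable_siteUpdate_omega J hω0 hω2 x (hJ x) hg).measurable)
    (fun x _ _ hb => abs_siteUpdate_omega_le J ω x hb) l hfm hfb).1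

/-- **The engine instance** (`J = −Δ_lat + m²`, shifts fixing no site, `m² > 0`): the lexicographic
heat-bath sweep over ALL sites, `List.finRange (n+1)`, leaves the free `phi4_2d` law invariant:
`⟨Sweep f⟩ = ⟨f⟩`. -/
theorem heatBath_fullSweep_exact_shift {ι : Type*} [Fintype ι] (σ : ι → Equiv.Perm (Fin (n + 1)))
    {m2 : ℝ} (hm2 : 0 < m2) (hσ : ∀ μ x, σ μ x ≠ x) {f : (Fin (n + 1) → ℝ) → ℝ}
    (hfm : Measurable f) {B : ℝ} (hfb : ∀ φ, |f φ| ≤ B) :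
    gibbsExpect (shiftCoupling σ m2) 0
        (sweepOp (siteUpdate (shiftCoupling σ m2) 1) (List.finRange (n + 1)) f)
      = gibbsExpect (shiftCoupling σ m2) 0 f := by
  have hS := shiftCoupling_coercive_of_pos_mass σ (m2 := m2) le_rfl
  have hJ : ∀ x, 0 < shiftCoupling σ m2 x x := by
    intro x
    rw [shiftCoupling_diag σ m2 x (fun μ => hσ μ x)]
    positivity
  unfold gibbsExpect
  rw [heatBath_sweep_exact hm2 hS hJ (List.finRange (n + 1)) hfm hfb]

end Summit.Ventures.LatticeQCDFlow.Exactness
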